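import Literature.Analysis.ODE.ElementaryFieldVariationalCertificateFast
import Literature.Analysis.ODE.ElementaryFieldDoubletonChainCertificate
import HarnessLib

/-!
# The fast mean value step and doubleton hand-over for elementary fields

Trunk T-ANA (Analysis/ODE); namespace `Literature.Analysis.ODE`.

The third of four files of the fast (constant-folded) kernel checker for `C¹`-Lohner doubleton
transcripts (`CodeListSimplification.lean`, `ElementaryFieldVariationalCertificateFast.lean`, this
file, `ElementaryFieldDoubletonChainCertificateFast.lean`).  On top of the fast `C¹` step test
`EVarStepCert.checkS` (Jacobians of the flow Taylor coefficient maps by the constant-folded code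
lists `jacExprS`, with `D_xφ(h, [W]) ⊆ J1 = varEndBoxS`) this file re-proves, with the SAME
statements as the tree's `EMVStepCert.meanValue` and `EDStage.handover`:

* §1 `EMVStepCert.checkS`, `checkS_spec`, `exists_of_checkS`, `meanValueS` — Moore's mean value
  form of the flow map `z(h) = z_c(h) + M (x − m)` with `M ∈ [J1] = varEndBoxS`
  (Moore 1979 (4.19) for `f = φ(h, ·)`; Mrozek–Zgliczyński 2000 Theorem 7.5);
* §2 `EDStage.jacEndS`, `rearrBoxS`, `stepCheckS`, `stepCheckS_spec`, `rearr_subsetS`,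
  `handoverS` — the decidable doubleton hand-over test against the next node with `[J₁] = jacEndS`
  and its soundness `φ(h, 𝒟(r₀)) ⊆ 𝒟'(r₀)` (Mrozek–Zgliczyński Lemma 8.5 (★); Kapela–Zgliczyński
  2009 §6.4 Evaluation 4), the proof of `EDStage.handover` with `meanValueS`.

Design.  Nothing landed is modified: a second decidable test on the unchanged certificate
structures `EMVStepCert` / `EDStage` with its own soundness theorems; a transcript may pass one
test and fail the other (different code lists round differently), each is sound.  The chain,
the packaged verifier and a re-decided tree transcript are
`ElementaryFieldDoubletonChainCertificateFast.lean`.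

## References

* R. E. Moore, *Methods and Applications of Interval Analysis*, SIAM 1979: §3.4 (note after
  (3.19)), §4.3 eq. (4.19), §8.1 eq. (8.10). [Moore1979]
* M. Mrozek, P. Zgliczyński, *Set arithmetic and the enclosing problem in dynamics*, Ann. Polon.
  Math. 74 (2000), Theorem 7.5, §7.5 Lemma 7.6, §8 Lemma 8.5. [MrozekZgliczynski2000]
* T. Kapela, P. Zgliczyński, Discrete Contin. Dyn. Syst. B 11 (2009), §6.1, §6.4. [KapelaZgliczynski2009]
* P. Zgliczyński, *C¹-Lohner algorithm*, Found. Comput. Math. 2 (2002), §3. [Zgliczynski2002C1Lohner]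
* I. Walawska, D. Wilczak, Appl. Math. Comput. 291 (2016), §2.1. [WalawskaWilczak2016]
* A. Neumaier, *Interval Methods for Systems of Equations*, Cambridge UP 1990, §3.1 Prop. 3.1.2,
  Cor. 5.1.5. [Neumaier1991]
* N. S. Nedialkov, K. R. Jackson, J. D. Pryce, Reliable Computing 7 (2001), §3. [NedialkovJacksonPryce2001]
-/

set_option autoImplicit false

noncomputable section

open Set NonemptyInterval TopologicalSpace Matrix
open scoped ContDiff Pointwise
open Literature.Analysis.ValidatedNumerics Literature.Analysis.ValidatedNumerics.ITaylor
open Literature.Analysis.ODE.FExpr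

namespace Literature.Analysis.ODE

variable {n : ℕ}

/-! ### §1. The mean value form of the flow map from the fast test -/

/-- If every point of `W` carries a solution on `[0, T]` and every solution from `W` stays in
`S`, then any given solution `z` from `x ∈ W` is the member at `x` of some `IsSolutionFamily` on
`W`. [folklore] -/
private theorem exists_family_with_member' {F : (Fin n → ℝ) → Fin n → ℝ}
    {W S : Set (Fin n → ℝ)} {T : ℝ}
    (hex : ∀ x' ∈ W, ∃ y : ℝ → Fin n → ℝ, y 0 = x' ∧
      ∀ t ∈ Icc 0 T, HasDerivWithinAt y (F (y t)) (Icc 0 T) t)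
    (henc : ∀ x' ∈ W, ∀ y : ℝ → Fin n → ℝ, y 0 = x' →
      (∀ t ∈ Icc 0 T, HasDerivWithinAt y (F (y t)) (Icc 0 T) t) → ∀ t ∈ Icc 0 T, y t ∈ S)
    {x : Fin n → ℝ} (hx : x ∈ W) {z : ℝ → Fin n → ℝ} (hz0 : z 0 = x)
    (hz : ∀ t ∈ Icc 0 T, HasDerivWithinAt z (F (z t)) (Icc 0 T) t) :
    ∃ u : (Fin n → ℝ) → ℝ → Fin n → ℝ, u x = z ∧ IsSolutionFamily F S W T u := by
  classical
  choose y hy0 hy using hex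
  obtain ⟨u, hu⟩ : ∃ u : (Fin n → ℝ) → ℝ → Fin n → ℝ,
      u = fun x' => if x' = x then z else if h' : x' ∈ W then y x' h' else fun _ => x' :=
    ⟨_, rfl⟩
  have hux : u x = z := by
    rw [hu]
    exact if_pos rfl
  have hun : ∀ x' (h' : x' ∈ W), x' ≠ x → u x' = y x' h' := by
    intro x' h' hne
    rw [hu]
    exact (if_neg hne).trans (dif_pos h')
  refine ⟨u, hux, ?_, ?_, ?_⟩
  · intro x' hx'
    by_cases hxx : x' = x
    · rw [hxx, hux, hz0]
    · rw [hun x' hx' hxx]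
      exact hy0 x' hx'
  · intro x' hx' τ hτ
    by_cases hxx : x' = x
    · rw [hxx, hux]
      exact hz τ hτ
    · rw [hun x' hx' hxx]
      exact hy x' hx' τ hτ
  · intro x' hx' τ hτ
    by_cases hxx : x' = x
    · rw [hxx, hux]
      exact henc x hx z hz0 hz τ hτ
    · rw [hun x' hx' hxx]
      exact henc x' hx' _ (hy0 x' hx') (hy x' hx') τ hτ

namespace EMVStepCert

variable (c : EMVStepCert n)

/-- **The fast mean value step checker**: the fast `C¹` test, the a-priori state box is
non-degenerate, the centre lies in `W`, and the point certificate from the centre accepts.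
[cite: Moore1979, §4.3 eq. (4.19)] [cite: WalawskaWilczak2016, §2.1 (C¹ high-order enclosure)] -/
def checkS : Bool :=
  c.toEVarStepCert.checkS && posBox c.apriori && boxLE (pointBox c.center) c.init &&
    c.pointCert.check

variable {c}

/-- What an accepted fast certificate contains. [cite: WalawskaWilczak2016, §2.1 (C¹ high-order enclosure)]
[cite: Moore1979, §4.3 eq. (4.19) (m ∈ X)] -/
theorem checkS_spec (hc : c.checkS = true) :
    c.toEVarStepCert.checkS = true ∧ posBox c.apriori = true ∧
      boxLE (pointBox c.center) c.init = true ∧ c.pointCert.check = true := by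
  simp only [checkS, Bool.and_eq_true] at hc
  exact ⟨hc.1.1.1, hc.1.1.2, hc.1.2, hc.2⟩

/-- **Existence** from the fast test: every `x ∈ W` carries a solution of `y' = f(y)` on `[0, h]`
(state half). [cite: Moore1979, §8.1 eq. (8.10)] [cite: NedialkovJacksonPryce2001, §3 (constant / Taylor a-priori enclosure)] -/
theorem exists_of_checkS (hc : c.checkS = true) {x : Fin n → ℝ}
    (hx : x ∈ boxSet (castBox c.init)) :
    ∃ y : ℝ → Fin n → ℝ, y 0 = x ∧
      ∀ t ∈ Icc 0 (c.step : ℝ),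
        HasDerivWithinAt y (fieldFun c.field (y t)) (Icc 0 (c.step : ℝ)) t :=
  (EStepCert.sound (EVarStepCert.checkS_spec (checkS_spec hc).1).1 hx).1

/-- **THE MEAN VALUE FORM OF THE FLOW MAP from the fast test** (Moore 1979 (4.19) for
`f = φ(h, ·)`; Mrozek–Zgliczyński 2000 Theorem 7.5): for every `x ∈ W` and every solution `z` from
`x` on `[0, h]` there are a solution `z_c` from the centre `m` and a real matrix `M` with entries in
`J1 = varEndBoxS` such that `z(h) = z_c(h) + M (x − m)` — the proof of `meanValue` with
`hasFDerivWithinAt_flow_stepS`. [cite: Moore1979, §4.3 eq. (4.19)]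
[cite: MrozekZgliczynski2000, Theorem 7.5] [cite: Neumaier1991, Cor. 5.1.5] -/
theorem meanValueS (hc : c.checkS = true) {x : Fin n → ℝ} (hx : x ∈ boxSet (castBox c.init))
    {z : ℝ → Fin n → ℝ} (hz0 : z 0 = x)
    (hz : ∀ t ∈ Icc 0 (c.step : ℝ),
      HasDerivWithinAt z (fieldFun c.field (z t)) (Icc 0 (c.step : ℝ)) t) :
    ∃ zc : ℝ → Fin n → ℝ, (zc 0 = fun l => (c.center l : ℝ)) ∧
      (∀ t ∈ Icc 0 (c.step : ℝ),
        HasDerivWithinAt zc (fieldFun c.field (zc t)) (Icc 0 (c.step : ℝ)) t) ∧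
      ∃ M : Matrix (Fin n) (Fin n) ℝ, (∀ i l, M i l ∈ castMat c.varEndBoxS i l) ∧
        z c.step = zc c.step + M *ᵥ (x - fun l => (c.center l : ℝ)) := by
  obtain ⟨hcV, hpos, hcen, -⟩ := checkS_spec hc
  have h1 : c.toE.check = true := (EVarStepCert.checkS_spec hcV).1
  have hcW : (fun l => (c.center l : ℝ)) ∈ boxSet (castBox c.init) := ratVec_mem_of_boxLE hcen
  have hex : ∀ x' ∈ boxSet (castBox c.init), ∃ y : ℝ → Fin n → ℝ, y 0 = x' ∧
      ∀ t ∈ Icc 0 (c.step : ℝ),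
        HasDerivWithinAt y (fieldFun c.field (y t)) (Icc 0 (c.step : ℝ)) t :=
    fun x' hx' => (EStepCert.sound h1 hx').1
  have henc : ∀ x' ∈ boxSet (castBox c.init), ∀ y : ℝ → Fin n → ℝ, y 0 = x' →
      (∀ t ∈ Icc 0 (c.step : ℝ),
        HasDerivWithinAt y (fieldFun c.field (y t)) (Icc 0 (c.step : ℝ)) t) →
      ∀ t ∈ Icc 0 (c.step : ℝ), y t ∈ boxSet (castBox c.apriori) :=
    fun x' hx' y hy0 hy t ht => ((EStepCert.sound h1 hx').2 y hy0 hy t ht).1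
  obtain ⟨u, hux, hu⟩ := exists_family_with_member' hex henc hx hz0 hz
  have hF : ∀ x' ∈ boxSet (castBox c.init), ∃ J : (Fin n → ℝ) →L[ℝ] (Fin n → ℝ),
      HasFDerivWithinAt (fun x'' => u x'' c.step) J (boxSet (castBox c.init)) x' ∧
        ∀ i l, J (Pi.single l 1) i ∈ castMat c.varEndBoxS i l :=
    fun x' hx' => EVarStepCert.hasFDerivWithinAt_flow_stepS hcV hpos hu hx'
  choose! Jf hJf hJmem using hF
  have hA : ∀ x' ∈ boxSet (castBox c.init), ∀ i l,
      (fun i l => ((c.varEndBoxS i l).fst : ℝ)) i l ≤ Jf x' (Pi.single l 1) i ∧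
        Jf x' (Pi.single l 1) i ≤ (fun i l => ((c.varEndBoxS i l).snd : ℝ)) i l :=
    fun x' hx' i l => mem_ratCast_iff.1 (hJmem x' hx' i l)
  obtain ⟨M, hM, hMeq⟩ := exists_matrixIcc_meanValue_of_hasFDerivWithinAt
    (F := fun x'' => u x'' c.step) (convex_boxSet (castBox c.init)) hJf hA hx hcW
  have hM' : ∀ i l,
      ((c.varEndBoxS i l).fst : ℝ) ≤ M i l ∧ M i l ≤ ((c.varEndBoxS i l).snd : ℝ) := hM
  refine ⟨u fun l => (c.center l : ℝ), hu.init _ hcW, hu.hasDerivWithinAt _ hcW, M,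
    fun i l => mem_ratCast_iff.2 (hM' i l), ?_⟩
  rw [← hux]
  exact hMeq

end EMVStepCert

/-! ### §2. One doubleton hand-over step, fast checker -/

section Doubleton

namespace EDStage

/-- The interval Jacobian `[J₁] ∋ ∂φ(h, ·)/∂y` over `[W]` of the fast `C¹` test
(`EVarStepCert.varEndBoxS`). [cite: Zgliczynski2002C1Lohner, §3 (C¹-Lohner algorithm)]
[cite: Moore1979, §3.4 (note after eq. (3.19))] -/
noncomputable def jacEndS (F : Fin n → FExpr n) (cfg : SeedCfg) (s : EDStage n) :
    Fin n → Fin n → Iv :=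
  (s.cert F cfg).varEndBoxS

/-- The interval evaluation of the right-hand side of the rearrangement (★) with `[J₁] = jacEndS`:
`(Q' [J₁] B) [R] + Q' ( ([φ(h,x)] − x') + ([J₁] C − C') [R⁰] )`.
[cite: MrozekZgliczynski2000, Lemma 8.5] [cite: KapelaZgliczynski2009, §6.1 and §6.4 (Evaluation 4)] -/
noncomputable def rearrBoxS (F : Fin n → FExpr n) (cfg : SeedCfg) (R0 : Fin n → Iv) (s : EDStage n)
    (ν' : DNode n) : Fin n → Iv :=
  imatvecQ (imatmulQ (pointMat ν'.binv) (imatmulQ (s.jacEndS F cfg) (pointMat s.node.bmat)))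
      s.node.rem +
    imatvecQ (pointMat ν'.binv)
      (shiftBox (s.pointEnd F cfg) ν'.center +
        imatvecQ (shiftMat (imatmulQ (s.jacEndS F cfg) (pointMat s.node.cmat)) ν'.cmat) R0)

/-- THE FAST DECIDABLE HAND-OVER TEST against the next node `ν'`: the fast mean value step
certificate checks, `[W] ⊇ hull(node)`, `Q' B' = 1` exactly, and `rearrBoxS ⊆ [R']`.
[cite: MrozekZgliczynski2000, Lemma 8.5] [cite: MrozekZgliczynski2000, §7.5 Lemma 7.6]
[cite: Moore1979, §3.4 (note after eq. (3.19))] -/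
noncomputable def stepCheckS (F : Fin n → FExpr n) (cfg : SeedCfg) (R0 : Fin n → Iv) (s : EDStage n)
    (ν' : DNode n) : Bool :=
  (s.cert F cfg).checkS && boxLE (s.node.dHull R0) s.init && isOneQ (mulQ ν'.binv ν'.bmat) &&
    boxLE (s.rearrBoxS F cfg R0 ν') ν'.rem

variable {F : Fin n → FExpr n} {cfg : SeedCfg} {R0 : Fin n → Iv} {s : EDStage n} {ν' : DNode n}

/-- The four conjuncts of an accepted fast hand-over test. [cite: MrozekZgliczynski2000, Lemma 8.5]
[cite: MrozekZgliczynski2000, §7.5 Lemma 7.6] -/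
theorem stepCheckS_spec (h : s.stepCheckS F cfg R0 ν' = true) :
    (s.cert F cfg).checkS = true ∧ boxLE (s.node.dHull R0) s.init = true ∧
      isOneQ (mulQ ν'.binv ν'.bmat) = true ∧ boxLE (s.rearrBoxS F cfg R0 ν') ν'.rem = true := by
  simp only [stepCheckS, Bool.and_eq_true] at h
  exact ⟨h.1.1.1, h.1.1.2, h.1.2, h.2⟩

/-- A point of the node's doubleton lies in the state box `[W]`: the doubleton is inside its
interval hull (Mrozek–Zgliczyński Lemma 8.1) and the accepted hull test `hull(node) ⊆ [W]`.
[cite: MrozekZgliczynski2000, Lemma 8.1] [cite: Neumaier1991, §3.1 Proposition 3.1.2 (6)–(7)] -/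
theorem mem_initS (h : s.stepCheckS F cfg R0 ν' = true) {r₀ : Fin n → ℝ}
    (hr₀ : r₀ ∈ boxSet (castBox R0)) {u : Fin n → ℝ} (hu : u ∈ s.node.dset r₀) :
    u ∈ boxSet (castBox s.init) :=
  boxSet_mono (castBox_mono (le_of_boxLE (stepCheckS_spec h).2.1)) (DNode.dset_subset_dHull hr₀ hu)

/-- **The interval side of (★)** with `[J₁] = jacEndS`: the set-arithmetic right-hand side of the
rearrangement is contained in the real box of `rearrBoxS` (the proof of `rearr_subset`).
[cite: MrozekZgliczynski2000, Lemma 8.5] [cite: Neumaier1991, §3.1 Proposition 3.1.2 (6)–(7)] -/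
theorem rearr_subsetS (F : Fin n → FExpr n) (cfg : SeedCfg) (R0 : Fin n → Iv) (s : EDStage n)
    (ν' : DNode n) :
    image2 mulVec ({castQMat ν'.binv} *
          ({M : Matrix (Fin n) (Fin n) ℝ | ∀ i l, M i l ∈ castMat (s.jacEndS F cfg) i l} *
            {castQMat s.node.bmat})) (boxSet (castBox s.node.rem)) +
        image2 mulVec {castQMat ν'.binv}
          (boxSet (castBox (shiftBox (s.pointEnd F cfg) ν'.center)) +
            image2 mulVec ((fun J => J * castQMat s.node.cmat - castQMat ν'.cmat) ''
                {M : Matrix (Fin n) (Fin n) ℝ | ∀ i l, M i l ∈ castMat (s.jacEndS F cfg) i l})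
              (boxSet (castBox R0))) ⊆
      boxSet (castBox (s.rearrBoxS F cfg R0 ν')) := by
  rintro _ ⟨a, ha, b, hb, rfl⟩
  obtain ⟨P₁, hP₁, r, hr, rfl⟩ := ha
  obtain ⟨Q₁, hQ₁, JB, hJB, rfl⟩ := hP₁
  obtain ⟨J', hJ', B₁, hB₁, rfl⟩ := hJB
  rw [mem_singleton_iff] at hQ₁ hB₁
  subst hQ₁ hB₁
  obtain ⟨Q₂, hQ₂, v, hv, rfl⟩ := hb
  rw [mem_singleton_iff] at hQ₂
  subst hQ₂
  obtain ⟨e, he, d, hd, rfl⟩ := hv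
  obtain ⟨D, hD, r₀', hr₀', rfl⟩ := hd
  obtain ⟨J'', hJ'', rfl⟩ := hD
  have hD' : ∀ i l, (J'' * castQMat s.node.cmat - castQMat ν'.cmat) i l ∈
      castMat (shiftMat (imatmulQ (s.jacEndS F cfg) (pointMat s.node.cmat)) ν'.cmat) i l := by
    intro i l
    rw [Matrix.sub_apply, castQMat_apply]
    exact sub_mem_shiftMat (mul_mem_imatmulQ hJ'' (castQMat_mem_pointMat _)) i l
  have hv' : ∀ l, (e + (J'' * castQMat s.node.cmat - castQMat ν'.cmat) *ᵥ r₀') l ∈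
      castBox (shiftBox (s.pointEnd F cfg) ν'.center +
        imatvecQ (shiftMat (imatmulQ (s.jacEndS F cfg) (pointMat s.node.cmat)) ν'.cmat) R0) l := by
    intro l
    simp only [Pi.add_apply, castBox_apply, QMvPoly.ratCast_add]
    exact add_mem_add' ((mem_boxSet_iff.1 he) l) (mulVec_mem_imatvecQ hD' (mem_boxSet_iff.1 hr₀') l)
  rw [mem_boxSet_iff]
  intro i
  simp only [rearrBoxS, Pi.add_apply, castBox_apply, QMvPoly.ratCast_add]
  exact add_mem_add'
    (mulVec_mem_imatvecQ (mul_mem_imatmulQ (castQMat_mem_pointMat _)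
      (mul_mem_imatmulQ hJ' (castQMat_mem_pointMat _))) (mem_boxSet_iff.1 hr) i)
    (mulVec_mem_imatvecQ (castQMat_mem_pointMat _) hv' i)

/-- **THE CERTIFIED HAND-OVER STEP from the fast test** (soundness of `stepCheckS`): if the stage
checks against `ν'`, then for every `r₀ ∈ [R⁰]`, every point `u` of the node's doubleton and every
solution `z` of `y' = f(y)` on `[0, h]` with `z(0) = u`, `z(h)` lies in the next doubleton
`𝒟'(r₀)` — the proof of `handover` with `EMVStepCert.meanValueS` (`M ∈ [J₁] = jacEndS`).
[cite: MrozekZgliczynski2000, Lemma 8.5] [cite: MrozekZgliczynski2000, Theorem 7.5]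
[cite: KapelaZgliczynski2009, §6.1 and §6.4 (Evaluation 4)] [cite: Zgliczynski2002C1Lohner, §3 (C¹-Lohner algorithm)] -/
theorem handoverS (hs : s.stepCheckS F cfg R0 ν' = true) {r₀ : Fin n → ℝ}
    (hr₀ : r₀ ∈ boxSet (castBox R0)) {u : Fin n → ℝ} (hu : u ∈ s.node.dset r₀)
    {z : ℝ → Fin n → ℝ} (hz0 : z 0 = u)
    (hz : ∀ t ∈ Icc 0 (s.step : ℝ),
      HasDerivWithinAt z (fieldFun F (z t)) (Icc 0 (s.step : ℝ)) t) :
    z s.step ∈ DNode.dset ν' r₀ := by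
  have hW := mem_initS hs hr₀ hu
  obtain ⟨r, hr, rfl⟩ := hu
  have hcert := (stepCheckS_spec hs).1
  obtain ⟨zc, hzc0, hzc, M, hM, hEq⟩ :=
    EMVStepCert.meanValueS (c := s.cert F cfg) hcert hW hz0 hz
  have hcv : (fun l => (((s.cert F cfg).center l : ℚ) : ℝ)) = s.node.centerVec := rfl
  rw [hcv] at hzc0 hEq
  rw [add_assoc, add_sub_cancel_left] at hEq
  have hEq' : z s.step =
      zc s.step + M *ᵥ (castQMat s.node.cmat *ᵥ r₀ + castQMat s.node.bmat *ᵥ r) := hEq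
  have hPE : zc s.step ∈ boxSet (castBox (s.pointEnd F cfg)) :=
    EStepCert.mem_endBox (EMVStepCert.checkS_spec hcert).2.2.2
      (ratVec_mem_pointBox s.node.center) hzc0 hzc
  have hQ : ∃ B₁ ∈ ({castQMat ν'.bmat} : Set (Matrix (Fin n) (Fin n) ℝ)),
      ∃ Q ∈ ({castQMat ν'.binv} : Set (Matrix (Fin n) (Fin n) ℝ)), Q * B₁ = 1 :=
    ⟨_, rfl, _, rfl, by
      rw [← castQMat_mul, ← mulQ_eq_mul, eq_one_of_isOneQ (stepCheckS_spec hs).2.2.1,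
        castQMat_one]⟩
  have hsub := (Set.add_subset_add (Set.image2_subset_left (Set.singleton_subset_iff.2 hr))
      (Set.image2_subset_left (Set.add_subset_add_left
        (Set.image2_subset_left (Set.singleton_subset_iff.2 hr₀))))).trans
    ((rearr_subsetS F cfg R0 s ν').trans
      (boxSet_mono (castBox_mono (le_of_boxLE (stepCheckS_spec hs).2.2.2))))
  have hmv : ∀ r₀' ∈ ({r₀} : Set (Fin n → ℝ)), ∀ r' ∈ ({r} : Set (Fin n → ℝ)),
      ∃ J ∈ {M' : Matrix (Fin n) (Fin n) ℝ | ∀ i l, M' i l ∈ castMat (s.jacEndS F cfg) i l},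
        (fun _ : Fin n → ℝ => z s.step)
              (s.node.centerVec + castQMat s.node.cmat *ᵥ r₀' + castQMat s.node.bmat *ᵥ r') -
            ν'.centerVec - J *ᵥ (castQMat s.node.cmat *ᵥ r₀' + castQMat s.node.bmat *ᵥ r') ∈
          boxSet (castBox (shiftBox (s.pointEnd F cfg) ν'.center)) := by
    intro r₀' hr₀' r' hr'
    rw [mem_singleton_iff] at hr₀' hr'
    rw [hr₀', hr']
    refine ⟨M, hM, ?_⟩
    show z s.step - ν'.centerVec - M *ᵥ (castQMat s.node.cmat *ᵥ r₀ + castQMat s.node.bmat *ᵥ r)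
      ∈ _
    rw [hEq', show zc (s.step : ℝ) + M *ᵥ (castQMat s.node.cmat *ᵥ r₀ + castQMat s.node.bmat *ᵥ r)
        - ν'.centerVec - M *ᵥ (castQMat s.node.cmat *ᵥ r₀ + castQMat s.node.bmat *ᵥ r)
        = zc s.step - ν'.centerVec by abel]
    exact mem_boxSet_iff.2 fun l => sub_mem_shiftBox hPE l
  obtain ⟨B₁, hB₁, r₁, hr₁, hEq₁⟩ :=
    doubleton_mem (f := fun _ => z s.step) (x := s.node.centerVec) (x₁ := ν'.centerVec)
      (C := castQMat s.node.cmat) (C₁ := castQMat ν'.cmat) (B := castQMat s.node.bmat)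
      (Bs₁ := {castQMat ν'.bmat}) (Qs := {castQMat ν'.binv})
      (rs₁ := boxSet (castBox ν'.rem)) hmv hQ hsub (mem_singleton r₀) (mem_singleton r)
  rw [mem_singleton_iff] at hB₁
  subst hB₁
  exact ⟨r₁, hr₁, hEq₁⟩

end EDStage

end Doubleton

end Literature.Analysis.ODE
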